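import Summits.AtomisticToContinuum.FouriersLaw.Theses.EmbeddedDrudeMourre
import Summits.AtomisticToContinuum.FouriersLaw.Theorems.EmbeddedDrudeMourreMourreDissolutionOddTowerFloor
import HarnessLib

/-!
# The `m`-body kinetic floor of inversion-odd profiles — stub `stub_oddStratumFloor` of line `parity-count-second-quantised-fgr`
(crux `EmbeddedDrudeMourre.MourreDissolution`, item stmt-AtomisticToContinuum-12594; helper file, `--supports`)

Registered stub A of the checked skeleton of line `parity-count-second-quantised-fgr` (lead c12), in
the skeleton's stub namespace
`Summit.AtomisticToContinuum.FouriersLaw.Theorems.MourreDissolution.ParityCountSecondQuantisedFgr`.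

For `ω₂ > 0` and an odd-sector gap of ALS's collision form `q = boltzmannForm ω₂ a b` there is ONE
constant `g > 0` such that for every number `m + 1` of legs and every measurable, coordinatewise
`2π`-periodic, globally odd (`F (-k) = -F k`), square-integrable `F` on the cell `(−π,π]^{m+1}`,
`g ∫ F² ≤ Σᵢ ∫ q(F(·ᵢ; k)) dk` (lower Lebesgue integrals; the form applied in leg `i`, the other
legs frozen).

Proof. This is a corollary of the two landed stubs of the sibling line `swap-odd-threshold-rigidity`:
the parity floor `stub_oddParityFloor` (`∫ F² ≤ Σᵢ ∫ ((F − F∘Rᵢ)/2)²` for globally odd `F`) is the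
antecedent of the tower floor `stub_oddTowerFloor`, whose consequent is the present statement up to
the order of the hypotheses and the spelling of coordinatewise periodicity
(`Function.Periodic (fun x => F (update k i x)) (2π)` evaluated at `x = k i`, with
`Function.update_eq_self`, gives `F (update k i (k i + 2π)) = F k`). The hypotheses `0 < a`, `0 < b`
are not needed.
-/

noncomputable section

namespace Summit.AtomisticToContinuum.FouriersLaw.Theorems.MourreDissolution.ParityCountSecondQuantisedFgr

open MeasureTheory Set Filter Topology Function Real
open scoped InnerProductSpace ENNReal
open Literature.MathematicalPhysics.KineticTheory
open Literature.MathematicalPhysics.KineticTheory.HeatConduction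
open Literature.MathematicalPhysics.KineticTheory.PhononBoltzmann

/-- **Stub A of line `parity-count-second-quantised-fgr` (`stub_oddStratumFloor`): the `m`-body
kinetic floor of inversion-odd profiles, uniform in `m`.**
For `ω₂ > 0` (and `a, b > 0`, unused) with `HasOddSectorGap ω₂ a b` there is one constant `g > 0`
such that for every `m` and every measurable `F : ℝ^{m+1} → ℝ`, `2π`-periodic in each coordinate,
jointly odd (`F (-k) = -F k`) and square-integrable on the cell `(−π,π]^{m+1}`,
`g ∫_{cell^{m+1}} F² ≤ Σᵢ ∫_{cell^{m+1}} q_{ω₂,a,b}(x ↦ F (update k i x)) dk`.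
Corollary of `MourreDissolution.stub_oddTowerFloor` applied to `MourreDissolution.stub_oddParityFloor`.
[cite: AokiLukkarinenSpohn2006, §4 (4.11)] -/
theorem stub_oddStratumFloor :
    ∀ ω₂ a b : ℝ, 0 < ω₂ → 0 < a → 0 < b → HasOddSectorGap ω₂ a b →
      ∃ g : ℝ, 0 < g ∧ ∀ (m : ℕ) (F : (Fin (m + 1) → ℝ) → ℝ),
        Measurable F →
        (∀ (i : Fin (m + 1)) (k : Fin (m + 1) → ℝ),
            Function.Periodic (fun x : ℝ => F (Function.update k i x)) (2 * π)) →
        (∀ k : Fin (m + 1) → ℝ, F (-k) = -F k) →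
        (∫⁻ k in Set.pi Set.univ (fun _ : Fin (m + 1) => Set.Ioc (-π) π),
            ENNReal.ofReal (F k ^ 2)) < ⊤ →
        ENNReal.ofReal g *
            (∫⁻ k in Set.pi Set.univ (fun _ : Fin (m + 1) => Set.Ioc (-π) π),
              ENNReal.ofReal (F k ^ 2)) ≤
          ∑ i : Fin (m + 1),
            ∫⁻ k in Set.pi Set.univ (fun _ : Fin (m + 1) => Set.Ioc (-π) π),
              boltzmannForm ω₂ a b (fun x : ℝ => F (Function.update k i x)) := by
  intro ω₂ a b hω _ha _hb hgap
  obtain ⟨g, hg, h⟩ :=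
    Summit.AtomisticToContinuum.FouriersLaw.Theorems.MourreDissolution.stub_oddTowerFloor
      Summit.AtomisticToContinuum.FouriersLaw.Theorems.MourreDissolution.stub_oddParityFloor
      ω₂ a b hω hgap
  refine ⟨g, hg, ?_⟩
  intro m F hF hper hodd hfin
  have hper' : ∀ (k : Fin (m + 1) → ℝ) (i : Fin (m + 1)),
      F (Function.update k i (k i + 2 * π)) = F k := by
    intro k i
    have hk := (hper i k) (k i)
    simp only [Function.update_eq_self] at hk
    exact hk
  exact h m F hodd hper' hF hfin

end Summit.AtomisticToContinuum.FouriersLaw.Theorems.MourreDissolution.ParityCountSecondQuantisedFgr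

end
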